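import Summits.ABC.IUTFork.Cor312PinnedIndTrivialEngineBeds
import HarnessLib

/-!
# [IUTchIII] Cor. 3.12 — THE PERMUTATION LAW: over abc-iut-w5-d230's split shells, (Ind)-trivial ⟺ every Θ-region is stable under every capsule permutation

Proof-only junction file (D-0012; NO definition, NO `Prop` fact) of the abc-iut cell (WAVE-5 prover abc-iut-w5-d068, gen 5), companion of the laws
of `Cor312PinnedIndTrivialBeds5` (v2 §4 SCALAR LAW, v3 §6 GENERATOR LAW, v3 §7 SIGN LAW) and `Cor312PinnedIndTrivialUnitLaw` (UNIT LAW) for the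
fourth shell signature of the beds of record — abc-iut-w5-d230's SPLIT SHELLS `SplitWitness.splitShells` (`Cor312PilotKummerSplitShells`, p431201:
split packet `(ℚ²)^{⊗(j+1)}` over the two-point fibre, TRIVIAL «Ism», so that the only indeterminacies are print's (Ind1) CAPSULE PERMUTATIONS of the
procession — [IUTchIII] Thm. 3.11 (i) «automorphisms of the procession of 𝒟^⊢-prime-strips», [IUTchIV] Thm. 1.10 Step (v), Dupuy–Hilado §4.7;
beds P♮₁ `splitSetting`, P♮ₑ `ExcursionWitness.excSetting`). TAKES NO SIDE on [IUTchIII] Cor. 3.12 or on any author; toy carriers; instantiated ≠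
endorsed.

RESULTS (ns `Summit.ABC.IUTFork.Cor312Vol.IndTrivial`):
* `exists_mem_Ind1Family_apply_eq_permute_splitShells` — every capsule permutation `σ ∈ Perm(S^±_{j+1})` at a given label is realised by an
  (Ind1)-family (abc-iut-w5-d230's `permFamily`, the permutation `σ` at `j` and the identity at the other labels);
* **`indTrivial_iff_perm_stable_splitShells` — THE PERMUTATION LAW**: for ANY situation `⟨splitShells, D, G⟩` and ANY setting over it, (Ind)-trivial
  ⟺ every (Ind3)-enlarged Θ-region is stable under `permute σ` for every capsule permutation `σ` (⇐: abc-iut-w5-d230's closure lemma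
  `actsByPerm_of_mem_closure`); `possibleImages_eq_permOrbit_splitShells` — the possible images at a packet are EXACTLY the permutation orbit
  `{σ·A | σ ∈ Perm(S^±_{j+1})}` of `A = thetaRegion3`; `not_indTrivial_of_perm_moves_splitShells` — one permutation moving one region refutes
  (the shape of the P♮₁ cell `splitSetting_not_indTrivial` via `swapLast`, and of the P♮ₑ cell `excSetting_not_indTrivial` via `moveLast 0`).
So over the split shells the (Ind)-content of a bed is ONE BIT of its Θ-region — symmetric under the capsule permutations or not — and the
holomorphic hull `ⁿ˒°𝒰` is the frame-hull of the PERMUTATION ORBIT of the Θ-region: the kernel form of print's «symmetrising with respect to the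
choice of i† ∈ I». Consumed BY NAME; standard axioms; typed ≠ proved. [claim: Mochizuki2012, status: disputed] [cite: DupuyHilado2020, §4.7]
[cite: ScholzeStix2018, §2.2 pp. 9–10]
-/

noncomputable section

open Set

namespace Summit.ABC.IUTFork.Cor312Vol.IndTrivial

open Thm311 Cor312 Cor312.IdentifiedNonVacuity Cor312Vol NaiveWitness NaturalWitness SplitWitness Literature.IUT.LogThetaLattice

section PermLaw

/-- **Every capsule permutation at a given label is realised by an (Ind1)-family of the split shells**: abc-iut-w5-d230's `permFamily` with `σ` at the
label `j` and the identity permutation elsewhere acts on the packet at `(j, v_ℚ)` as `permute σ`. [claim: Mochizuki2012, status: disputed] -/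
theorem exists_mem_Ind1Family_apply_eq_permute_splitShells (j : splitIndex.Label) (vQ : splitIndex.VQ) (σ : Equiv.Perm (splitIndex.Caps j)) :
    ∃ Φ ∈ splitShells.Ind1Family, ∀ x, Φ j vQ x = splitShells.permute j vQ σ x := by
  refine ⟨permFamily (Function.update (fun j' => Equiv.refl (splitIndex.Caps j')) j σ), permFamily_mem_Ind1Family _, fun x => ?_⟩
  show splitShells.permute j vQ (Function.update (fun j' => Equiv.refl (splitIndex.Caps j')) j σ j) x = _
  rw [Function.update_self]

variable (D : ℤ → MRData splitShells) (G : ∀ (n : ℤ) (j : splitIndex.LabelStar), GlobalDegrees splitShells j)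
  (P : Cor312.Setting (⟨splitShells, D, G⟩ : Situation splitIndex))

/-- **THE PERMUTATION LAW.** For ANY situation `⟨splitShells, D, G⟩` over abc-iut-w5-d230's split shells and ANY Cor.-3.12 setting `P` over it:
`P` is (Ind)-trivial **iff every (Ind3)-enlarged Θ-region is STABLE UNDER EVERY CAPSULE PERMUTATION** `permute σ`, `σ ∈ Perm(S^±_{j+1})`.
⇒: each `σ` is an (Ind1)-family (`exists_mem_Ind1Family_apply_eq_permute_splitShells`); ⇐: every element of ⟨(Ind1) ∪ (Ind2)⟩ acts on each
packet as some `permute σ` (abc-iut-w5-d230's `actsByPerm_of_mem_closure`; «Ism» is trivial here). The boxes `box (DTheta j)` of P♮₁ and the graded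
boxes `gbox (lastDepth j j²)` of P♮ₑ are NOT permutation-stable (`splitSetting_not_indTrivial`, `excSetting_not_indTrivial`); a box with a
SYMMETRIC depth profile would be. [claim: Mochizuki2012, status: disputed] -/
theorem indTrivial_iff_perm_stable_splitShells :
    (∀ Φ ∈ Setting.indGroup (⟨splitShells, D, G⟩ : Situation splitIndex), ∀ (j : splitIndex.Label) (vQ : splitIndex.VQ),
        Φ j vQ '' P.thetaRegion3 j vQ = P.thetaRegion3 j vQ) ↔
      ∀ (j : splitIndex.Label) (vQ : splitIndex.VQ) (σ : Equiv.Perm (splitIndex.Caps j)),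
        splitShells.permute j vQ σ '' P.thetaRegion3 j vQ = P.thetaRegion3 j vQ := by
  constructor
  · intro hfix j vQ σ
    obtain ⟨Φ, hΦ, hΦσ⟩ := exists_mem_Ind1Family_apply_eq_permute_splitShells j vQ σ
    rw [← Set.image_congr fun x (_ : x ∈ P.thetaRegion3 j vQ) => hΦσ x]
    exact hfix Φ (Subgroup.subset_closure (Or.inl hΦ)) j vQ
  · intro hperm Φ hΦ j vQ
    obtain ⟨σ, hσ⟩ := actsByPerm_of_mem_closure hΦ j vQ
    rw [Set.image_congr fun x (_ : x ∈ P.thetaRegion3 j vQ) => hσ x]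
    exact hperm j vQ σ

/-- **The possible images over the split shells are the PERMUTATION ORBIT of the Θ-region** `{permute σ '' A | σ ∈ Perm(S^±_{j+1})}`,
`A = thetaRegion3` — so the holomorphic hull `ⁿ˒°𝒰_{j,v_ℚ}` is the frame-hull of the orbit `⋃_σ σ·A` (the «symmetrised» region of [IUTchIV]
Thm. 1.10 Step (v); abc-iut-rp-h3's `excSetting_thetaHull` is the instance `gbox (topDepth j j²)`). [claim: Mochizuki2012, status: disputed] -/
theorem possibleImages_eq_permOrbit_splitShells (j : splitIndex.Label) (vQ : splitIndex.VQ) :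
    P.possibleImages j vQ =
      {U | ∃ σ : Equiv.Perm (splitIndex.Caps j), U = splitShells.permute j vQ σ '' P.thetaRegion3 j vQ} := by
  ext U
  constructor
  · rintro ⟨Φ, hΦ, rfl⟩
    obtain ⟨σ, hσ⟩ := actsByPerm_of_mem_closure hΦ j vQ
    exact ⟨σ, Set.image_congr fun x _ => hσ x⟩
  · rintro ⟨σ, rfl⟩
    obtain ⟨Φ, hΦ, hΦσ⟩ := exists_mem_Ind1Family_apply_eq_permute_splitShells j vQ σ
    exact ⟨Φ, Subgroup.subset_closure (Or.inl hΦ), (Set.image_congr fun x _ => hΦσ x).symm⟩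

/-- … so the union of the possible images is the orbit `⋃_σ permute σ '' A`. [folklore] -/
theorem sUnion_possibleImages_splitShells (j : splitIndex.Label) (vQ : splitIndex.VQ) :
    ⋃₀ P.possibleImages j vQ = ⋃ σ : Equiv.Perm (splitIndex.Caps j), splitShells.permute j vQ σ '' P.thetaRegion3 j vQ := by
  rw [possibleImages_eq_permOrbit_splitShells D G P j vQ]
  ext x
  simp only [Set.mem_sUnion, Set.mem_setOf_eq, Set.mem_iUnion]
  constructor
  · rintro ⟨U, ⟨σ, rfl⟩, hx⟩
    exact ⟨σ, hx⟩
  · rintro ⟨σ, hx⟩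
    exact ⟨_, ⟨σ, rfl⟩, hx⟩

/-- The holomorphic hull over the split shells is the frame-hull of the permutation orbit of the Θ-region. [claim: Mochizuki2012, status: disputed] -/
theorem thetaHull_splitShells (j : splitIndex.Label) (vQ : splitIndex.VQ) :
    P.thetaHull j vQ = (P.frame j vQ).hull (⋃ σ : Equiv.Perm (splitIndex.Caps j), splitShells.permute j vQ σ '' P.thetaRegion3 j vQ) := by
  unfold Setting.thetaHull
  rw [sUnion_possibleImages_splitShells D G P j vQ]

/-- One-witness form of NON-triviality over the split shells: a single capsule permutation moving one Θ-region refutes (Ind)-triviality — the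
shape of the P♮₁ cell (`swapLast`) and of the P♮ₑ cell (`moveLast 0`). [folklore] -/
theorem not_indTrivial_of_perm_moves_splitShells {j : splitIndex.Label} {vQ : splitIndex.VQ} (σ : Equiv.Perm (splitIndex.Caps j))
    (hne : splitShells.permute j vQ σ '' P.thetaRegion3 j vQ ≠ P.thetaRegion3 j vQ) :
    ¬ ∀ Φ ∈ Setting.indGroup (⟨splitShells, D, G⟩ : Situation splitIndex), ∀ (j : splitIndex.Label) (vQ : splitIndex.VQ),
        Φ j vQ '' P.thetaRegion3 j vQ = P.thetaRegion3 j vQ := fun hfix =>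
  hne ((indTrivial_iff_perm_stable_splitShells D G P).1 hfix j vQ σ)

end PermLaw

end Summit.ABC.IUTFork.Cor312Vol.IndTrivial

end
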